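import Summits.QuantumFields.YangMills.Theorems.InfiniteVolumeTranslations
import Summits.QuantumFields.YangMills.Theorems.InfiniteVolumeSlackUniformBound
import HarnessLib

/-!
# Infinite volume by compactness with PER-ORDER collar constants AND UV SLACK: the compactness step and translations

Support file for `SlackWindow.SlackCalibration` (stmt-QuantumFields-23098; planner ym-idea-11 g8, LINE 1 «wuc»).  Verbatim twin of
the landed `InfiniteVolumePerOrderCompactness` (support of `TypicalExteriorCeilings.FactorialCalibration`) with the per-order collar
currency `(Cn n/R⁴)ⁿ` replaced by route `SlackWindow`'s SLACK currency `(Cn n/R⁴·((R·a)⁻¹)^σ)ⁿ` (`σ : ℕ`; `σ = 0` is the landed case)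
and the E0′ constant accordingly (`K n = ((2Cₚ)·4⁴5⁶ + (2Cₚ)·2⁶·22⁴ + 2^{σ+11}·(Cn n)·(2/ℓ₄+48)^{σ+4})·2⁶·(81·Σ 1/(m+1)²)`, Schwartz
norm of order `(σ+10)n`, prefactor `7`), through the slack series bound `Slack.norm_tsum_weight_mul_le_slack`.  Every deep lemma
(`exists_clm_eq_tsum`, `exists_subseq_clm_limit`, `translate_eq_of_tendsto`, `tsum_weight_mul_translateMulti`, …) is cited BY NAME.

WHAT IS PROVED ([folklore] throughout): `momentBound_oddTorusLimitPoints`, `exists_subseq_limit_of_zdCollar`,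
`exists_subseq_limit_oddTorusLimitPoints`, `translateMulti_invariant_of_tendsto_oddTorusLimitPoints`,
`exists_subseq_limit_translate_oddTorusLimitPoints` — the landed statements with the slack currency.

HONEST FRAMING: nothing here is a statement about Bałaban's renormalisation group, reflection positivity, a mass gap or Clay; the
ceilings are HYPOTHESES.  No summit is proved (rung R2a plumbing).
References: Glimm–Jaffe (1987) §6.1; Osterwalder–Schrader CMP 42 (1975) §2; Chatterjee arXiv:1803.01950 §2.
-/

set_option autoImplicit false

noncomputable section

open scoped BigOperators SchwartzMap
open MeasureTheory Filter Topology
open Literature.MathematicalPhysics.QuantumFieldTheory hiding ZdEdge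
open Literature.MathematicalPhysics.QuantumLattice
open Literature.MathematicalPhysics.AQFT
open Literature.Probability.LatticeModels (box Site)
open Summit.QuantumFields.YangMills.Cruxes.OSLegsFromFemtoAndGap.DlrCollarTransfer
  (plane torusE exists_abs_plane_le continuous_plane isCylinder_plane)
open Summit.QuantumFields.YangMills.Theorems.OSLegsFromFemtoAndGap (exists_subseq_clm_limit)
open Summit.QuantumFields.YangMills.Theorems.InfiniteVolume.Slack (norm_tsum_weight_mul_le_slack)

namespace Summit.QuantumFields.YangMills.Theorems.InfiniteVolume.PerOrderSlack

/-! ## §1 Inheritance of the per-order torus collar bound by odd-torus limit states -/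

section Inheritance

variable {G : Type} [Group G] [TopologicalSpace G] [IsTopologicalGroup G] [CompactSpace G]
  [MeasurableSpace G] [BorelSpace G]

/-- **THE INHERITANCE, per-order constants.**  If the per-torus-centred mixed plane moments at torus-separated sites
are `≤ (Cn n/R⁴)ⁿ` on every odd torus with `4R+8 ≤ L` (`β ≥ β₄`, `1 ≤ R`, `R·a β ≤ ℓ₄`), then with the SAME constants
every `μ ∈ oddTorusLimitPoints r β` has `|∫ ∏ᵢ (plane qᵢ xᵢ − ∫ plane qᵢ xᵢ dμ) dμ| ≤ (Cn n/R⁴)ⁿ` for `ℤ⁴`-separated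
plane strings (verbatim `InfiniteVolume.momentBounds6_oddTorusLimitPoints` with `C ↦ Cn n`). [folklore] -/
theorem momentBound_oddTorusLimitPoints (r : LatticeRep G) {a : ℝ → ℝ} (Cn : ℕ → ℝ) (σ : ℕ) {β₄ ℓ₄ : ℝ}
    (hMB : ∀ β : ℝ, β₄ ≤ β →
      ∀ (L n : ℕ) (q : Fin n → Fin 4 × Fin 4) (x : Fin n → (Fin 4 → ℤ)) (R : ℕ), (∀ i, (q i).1 < (q i).2) →
        1 ≤ R → (R : ℝ) * a β ≤ ℓ₄ → 4 * R + 8 ≤ L →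
        (∀ i j : Fin n, i ≠ j → ∃ k : Fin 4,
          (2 * (R : ℤ) + 4) ≤ |((((x i k - x j k : ℤ) : ZMod (2 * L + 1))).valMinAbs : ℤ)|) →
        |torusE G r β L (fun U => ∏ i, (plane G r (q i) (x i) U - torusE G r β L (plane G r (q i) (x i))))| ≤
          (Cn n / (R : ℝ) ^ 4 * (((R : ℝ) * a β)⁻¹) ^ σ) ^ n)
    {β : ℝ} (hβ : β₄ ≤ β) {μ : Measure (LGConfig 4 G)} (hμ : μ ∈ oddTorusLimitPoints r β)
    {n : ℕ} (q : Fin n → Fin 4 × Fin 4) (x : Fin n → (Fin 4 → ℤ)) (R : ℕ) (hq : ∀ i, (q i).1 < (q i).2)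
    (hR : 1 ≤ R) (hRa : (R : ℝ) * a β ≤ ℓ₄)
    (hsep : ∀ i j : Fin n, i ≠ j → ∃ k : Fin 4, (2 * (R : ℤ) + 4) ≤ |x i k - x j k|) :
    |∫ U, ∏ i, (plane G r (q i) (x i) U - ∫ V, plane G r (q i) (x i) V ∂μ) ∂μ| ≤ (Cn n / (R : ℝ) ^ 4 * (((R : ℝ) * a β)⁻¹) ^ σ) ^ n := by
  obtain ⟨S, hS, hlim⟩ := hμ
  obtain ⟨Cp, hCp⟩ := exists_abs_plane_le (G := G) r
  refine abs_integral_centred_prod_le_of_eventually r.ρ r.continuous hlim (fun i => plane G r (q i) (x i))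
    (fun i => ⟨_, isCylinder_plane r (q i) (x i)⟩) (fun i => continuous_plane r (q i) (x i))
    (fun i => measurable_plane r (q i) (x i)) (fun i => ⟨Cp, hCp (q i) (x i)⟩) ?_
  filter_upwards [eventually_torusSeparated x hsep hS, eventually_le_of_strictMono hS (4 * R + 8)]
    with k hsepk hRk
  exact hMB β hβ (S k) n q x R hq hR hRa hRk hsepk

end Inheritance

/-! ## §2 The compactness step in infinite volume, abstract weights, per-order collar constants -/

section Compactness

/-- **THE COMPACTNESS STEP, ABSTRACT FORM, PER-ORDER CONSTANTS** (verbatim `InfiniteVolume.exists_subseq_limit_of_zdCollar`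
with the collar constant `Cn n` depending on the arity and the E0′ constant `K n` accordingly; `exists_subseq_clm_limit`
accepts per-index bounds). [folklore] -/
theorem exists_subseq_limit_of_zdCollar {ℓ₄ M : ℝ} (Cn : ℕ → ℝ) (σ : ℕ) (hℓ : 0 < ℓ₄) (hC : ∀ n, 0 ≤ Cn n) (hM : 0 ≤ M)
    (a : ℕ → ℝ) (ha : ∀ k, 0 < a k) (ha24 : ∀ k, a k ≤ 1 / 24) (haℓ : ∀ k, a k ≤ ℓ₄)
    (W : ℕ → (n : ℕ) → (Fin n → Fin 4 × Fin 4) → (Fin n → Site 4) → ℝ)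
    (hWsup : ∀ k n q x, |W k n q x| ≤ M ^ n)
    (hWcol : ∀ (k n : ℕ) (q : Fin n → Fin 4 × Fin 4), (∀ i, (q i).1 < (q i).2) →
      ∀ (x : Fin n → Site 4) (R : ℕ), 1 ≤ R → (R : ℝ) * a k ≤ ℓ₄ →
        (∀ i j : Fin n, i ≠ j → ∃ m : Fin 4, (2 * (R : ℤ) + 4) ≤ |x i m - x j m|) →
        |W k n q x| ≤ (Cn n / (R : ℝ) ^ 4 * (((R : ℝ) * a k)⁻¹) ^ σ) ^ n)
    (y : ℕ → (n : ℕ) → (Fin n → Fin 4 × Fin 4) → (Fin n → Site 4) → (Fin n → EuclideanSpace ℝ (Fin 4)))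
    (hy : ∀ k n q x l, ‖y k n q x l - a k • siteToE (x l)‖ ≤ 6 * a k) :
    ∃ φ : ℕ → ℕ, StrictMono φ ∧
      ∃ S : (n : ℕ) → (Fin n → Fin 4 × Fin 4) → (𝓢((Fin n → EuclideanSpace ℝ (Fin 4)), ℂ) →L[ℂ] ℂ),
        (∀ n q F, ‖S n q F‖ ≤
          7 * (((M * 4 ^ 4 * 5 ^ 6 + M * 2 ^ 6 * (10 + 2 * 6) ^ 4 + 2 ^ (σ + 11) * Cn n * (2 / ℓ₄ + 48) ^ (σ + 4)) * 2 ^ 6 *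
            (81 * ∑' m : ℕ, (((m : ℝ) + 1) ^ 2)⁻¹)) ^ n) * schwartzNorm ((σ + 10) * n) F) ∧
        ∀ n : ℕ, 2 ≤ n → ∀ q : Fin n → Fin 4 × Fin 4, (∀ i, (q i).1 < (q i).2) →
          ∀ F : 𝓢((Fin n → EuclideanSpace ℝ (Fin 4)), ℂ), IsOffDiagonal F →
            Tendsto (fun j => ∑' x : Fin n → Site 4, ((W (φ j) n q x : ℝ) : ℂ) * F (y (φ j) n q x)) atTop
              (𝓝 (S n q F)) := by
  classical
  set K : ℕ → ℝ := fun n => (M * 4 ^ 4 * 5 ^ 6 + M * 2 ^ 6 * (10 + 2 * 6) ^ 4 + 2 ^ (σ + 11) * Cn n * (2 / ℓ₄ + 48) ^ (σ + 4)) *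
    2 ^ 6 * (81 * ∑' m : ℕ, (((m : ℝ) + 1) ^ 2)⁻¹) with hK
  have hK0 : ∀ n, 0 ≤ K n := fun n => by
    have : 0 ≤ ∑' m : ℕ, (((m : ℝ) + 1) ^ 2)⁻¹ := tsum_nonneg fun m => by positivity
    have := hC n
    simp only [hK]
    positivity
  have ha1 : ∀ k, a k ≤ 1 := fun k => (ha24 k).trans (by norm_num)
  have hsa : ∀ k, 6 * a k ≤ 1 / 4 := fun k => by linarith [ha24 k]
  have hMn : ∀ n : ℕ, 0 ≤ M ^ n := fun n => pow_nonneg hM n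
  -- the series functionals as continuous linear functionals
  have hT : ∀ (k n : ℕ) (q : Fin n → Fin 4 × Fin 4),
      ∃ T : 𝓢((Fin n → EuclideanSpace ℝ (Fin 4)), ℂ) →L[ℂ] ℂ,
        ∀ F, T F = ∑' x : Fin n → Site 4, ((W k n q x : ℝ) : ℂ) * F (y k n q x) := fun k n q =>
    exists_clm_eq_tsum (ha k) (ha1 k) (hsa k) (hMn n) (W k n q) (hWsup k n q) (y k n q) (hy k n q)
  choose T hT using hT
  -- the joint index and the off-diagonal submodules
  let ι := Σ n : ℕ, (Fin n → Fin 4 × Fin 4)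
  let Tι : (i : ι) → ℕ → (𝓢((Fin i.1 → EuclideanSpace ℝ (Fin 4)), ℂ) →L[ℂ] ℂ) := fun i k =>
    if 2 ≤ i.1 ∧ (∀ l, (i.2 l).1 < (i.2 l).2) then T k i.1 i.2 else 0
  let Mod : (i : ι) → Submodule ℂ 𝓢((Fin i.1 → EuclideanSpace ℝ (Fin 4)), ℂ) := fun i =>
    { carrier := {F | IsOffDiagonal F}
      add_mem' := fun hF hG => hF.add hG
      zero_mem' := isOffDiagonal_zero
      smul_mem' := fun c _ hF => hF.smul c }
  have hMod : ∀ i (F : 𝓢((Fin i.1 → EuclideanSpace ℝ (Fin 4)), ℂ)), F ∈ Mod i ↔ IsOffDiagonal F :=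
    fun i F => Iff.rfl
  -- the a-uniform bound on `⁰𝒮` (step 2), per order
  have hbound : ∀ i k, ∀ F ∈ Mod i, ‖Tι i k F‖ ≤ 7 * K i.1 ^ i.1 * schwartzNorm ((σ + 10) * i.1) F := by
    rintro ⟨n, q⟩ k F hF
    rw [hMod] at hF
    by_cases hn : 2 ≤ n ∧ (∀ l, (q l).1 < (q l).2)
    · simp only [Tι, if_pos hn, hT]
      exact norm_tsum_weight_mul_le_slack hℓ (hC n) hM σ (W k n q) (hWsup k n q) (hWcol k n q hn.2) (ha k) (ha1 k) (haℓ k)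
        hn.1 (by norm_num) le_rfl (hsa k) F hF (y k n q) (hy k n q)
    · simp only [Tι, if_neg hn, zero_apply, norm_zero]
      exact mul_nonneg (mul_nonneg (by norm_num) (pow_nonneg (hK0 _) _)) (schwartzNorm_nonneg _ _)
  obtain ⟨φ, hφ, Slim, hSlim, hconv⟩ := exists_subseq_clm_limit
    (X := fun i : ι => Fin i.1 → EuclideanSpace ℝ (Fin 4)) Tι Mod (fun i => (σ + 10) * i.1) (fun i => 7 * K i.1 ^ i.1)
    (fun i => mul_nonneg (by norm_num) (pow_nonneg (hK0 _) _)) hbound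
  refine ⟨φ, hφ, fun n q => Slim ⟨n, q⟩, fun n q F => ?_, fun n hn q hq F hF => ?_⟩
  · exact hSlim ⟨n, q⟩ F
  · have h := hconv ⟨n, q⟩ F ((hMod ⟨n, q⟩ F).2 hF)
    simp only [Tι, if_pos (And.intro hn hq), hT] at h
    exact h

end Compactness

/-! ## §3 The compactness step for odd-torus limit states, per-order constants -/

section OddTorus

variable {G : Type} [Group G] [TopologicalSpace G] [IsTopologicalGroup G] [CompactSpace G]
  [MeasurableSpace G] [BorelSpace G]

/-- **THE COMPACTNESS STEP FOR THERMODYNAMIC LIMIT STATES, per-order constants** (verbatim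
`InfiniteVolume.exists_subseq_limit_oddTorusLimitPoints` with a per-order collar bound `(Cn n/R⁴)ⁿ` as hypothesis and
the per-order E0′ constant `K n`). [folklore] -/
theorem exists_subseq_limit_oddTorusLimitPoints (r : LatticeRep G) {a : ℝ → ℝ} (Cn : ℕ → ℝ) (σ : ℕ) {β₄ ℓ₄ : ℝ}
    (hℓ : 0 < ℓ₄) (hC : ∀ n, 0 ≤ Cn n)
    (H : ∀ β : ℝ, β₄ ≤ β →
      ∀ (L n : ℕ) (q : Fin n → Fin 4 × Fin 4) (x : Fin n → (Fin 4 → ℤ)) (R : ℕ), (∀ i, (q i).1 < (q i).2) →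
        1 ≤ R → (R : ℝ) * a β ≤ ℓ₄ → 4 * R + 8 ≤ L →
        (∀ i j : Fin n, i ≠ j → ∃ k : Fin 4,
          (2 * (R : ℤ) + 4) ≤ |((((x i k - x j k : ℤ) : ZMod (2 * L + 1))).valMinAbs : ℤ)|) →
        |torusE G r β L (fun U => ∏ i, (plane G r (q i) (x i) U - torusE G r β L (plane G r (q i) (x i))))| ≤
          (Cn n / (R : ℝ) ^ 4 * (((R : ℝ) * a β)⁻¹) ^ σ) ^ n) :
    ∃ Cp : ℝ, 0 ≤ Cp ∧
      ∀ (β : ℕ → ℝ), (∀ k, β₄ ≤ β k) → (∀ k, 0 < a (β k)) → (∀ k, a (β k) ≤ 1 / 24) → (∀ k, a (β k) ≤ ℓ₄) →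
      ∀ (μ : ℕ → Measure (LGConfig 4 G)), (∀ k, μ k ∈ oddTorusLimitPoints r (β k)) →
      ∀ (y : ℕ → (n : ℕ) → (Fin n → Fin 4 × Fin 4) → (Fin n → Site 4) → (Fin n → EuclideanSpace ℝ (Fin 4))),
        (∀ k n q x l, ‖y k n q x l - a (β k) • siteToE (x l)‖ ≤ 6 * a (β k)) →
      ∃ φ : ℕ → ℕ, StrictMono φ ∧
        ∃ S : (n : ℕ) → (Fin n → Fin 4 × Fin 4) → (𝓢((Fin n → EuclideanSpace ℝ (Fin 4)), ℂ) →L[ℂ] ℂ),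
          (∀ n q F, ‖S n q F‖ ≤
            7 * ((((Cp + Cp) * 4 ^ 4 * 5 ^ 6 + (Cp + Cp) * 2 ^ 6 * (10 + 2 * 6) ^ 4 +
              2 ^ (σ + 11) * Cn n * (2 / ℓ₄ + 48) ^ (σ + 4)) * 2 ^ 6 * (81 * ∑' m : ℕ, (((m : ℝ) + 1) ^ 2)⁻¹)) ^ n) *
              schwartzNorm ((σ + 10) * n) F) ∧
          ∀ n : ℕ, 2 ≤ n → ∀ q : Fin n → Fin 4 × Fin 4, (∀ i, (q i).1 < (q i).2) →
            ∀ F : 𝓢((Fin n → EuclideanSpace ℝ (Fin 4)), ℂ), IsOffDiagonal F →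
              Tendsto (fun j => ∑' x : Fin n → Site 4,
                (((∫ U, ∏ i, (plane G r (q i) (x i) U - ∫ V, plane G r (q i) (x i) V ∂(μ (φ j))) ∂(μ (φ j)) : ℝ)
                  : ℂ)) * F (y (φ j) n q x)) atTop (𝓝 (S n q F)) := by
  obtain ⟨Cp, hCp⟩ := exists_abs_plane_le (G := G) r
  have hCp0 : 0 ≤ Cp := le_trans (abs_nonneg _) (hCp (0, 1) 0 (fun _ => 1))
  refine ⟨Cp, hCp0, ?_⟩
  intro β hβ ha ha24 haℓ μ hμ y hy
  haveI : ∀ k, IsProbabilityMeasure (μ k) := fun k => by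
    obtain ⟨S, -, hlim⟩ := hμ k
    exact hlim.1
  obtain ⟨φ, hφ, S, hS, hconv⟩ := exists_subseq_limit_of_zdCollar Cn σ hℓ hC (by positivity : 0 ≤ Cp + Cp)
    (fun k => a (β k)) ha ha24 haℓ
    (fun k n q x => ∫ U, ∏ i, (plane G r (q i) (x i) U - ∫ V, plane G r (q i) (x i) V ∂(μ k)) ∂(μ k))
    (fun k n q x => abs_infVolWeight_le r hCp (μ k) q x)
    (fun k n q hq x R hR hRa hsep => momentBound_oddTorusLimitPoints r Cn σ H (hβ k) (hμ k) q x R hq hR hRa hsep)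
    y hy
  exact ⟨φ, hφ, S, hS, hconv⟩

/-- **TRANSLATION INVARIANCE OF THE LIMIT, per-order constants** (verbatim
`InfiniteVolume.translateMulti_invariant_of_tendsto_oddTorusLimitPoints` with `C ↦ Cn n`). [folklore] -/
theorem translateMulti_invariant_of_tendsto_oddTorusLimitPoints (r : LatticeRep G) {a : ℝ → ℝ} (Cn : ℕ → ℝ) (σ : ℕ)
    {β₄ ℓ₄ : ℝ} (hℓ : 0 < ℓ₄) (hC : ∀ n, 0 ≤ Cn n)
    (H : ∀ β : ℝ, β₄ ≤ β →
      ∀ (L n : ℕ) (q : Fin n → Fin 4 × Fin 4) (x : Fin n → (Fin 4 → ℤ)) (R : ℕ), (∀ i, (q i).1 < (q i).2) →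
        1 ≤ R → (R : ℝ) * a β ≤ ℓ₄ → 4 * R + 8 ≤ L →
        (∀ i j : Fin n, i ≠ j → ∃ k : Fin 4,
          (2 * (R : ℤ) + 4) ≤ |((((x i k - x j k : ℤ) : ZMod (2 * L + 1))).valMinAbs : ℤ)|) →
        |torusE G r β L (fun U => ∏ i, (plane G r (q i) (x i) U - torusE G r β L (plane G r (q i) (x i))))| ≤
          (Cn n / (R : ℝ) ^ 4 * (((R : ℝ) * a β)⁻¹) ^ σ) ^ n)
    (β : ℕ → ℝ) (hβ : ∀ k, β₄ ≤ β k) (ha : ∀ k, 0 < a (β k)) (ha24 : ∀ k, a (β k) ≤ 1 / 24)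
    (haℓ : ∀ k, a (β k) ≤ ℓ₄) (ha0 : Tendsto (fun k => a (β k)) atTop (𝓝 0))
    (μ : ℕ → Measure (LGConfig 4 G)) (hμ : ∀ k, μ k ∈ oddTorusLimitPoints r (β k))
    {n : ℕ} (hn : 2 ≤ n) (q : Fin n → Fin 4 × Fin 4) (hq : ∀ i, (q i).1 < (q i).2)
    (o : ℕ → Fin n → EuclideanSpace ℝ (Fin 4)) (ho : ∀ k l, ‖o k l‖ ≤ 5 * a (β k))
    {φ : ℕ → ℕ} (hφ : StrictMono φ) (S : 𝓢((Fin n → EuclideanSpace ℝ (Fin 4)), ℂ) → ℂ)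
    (hconv : ∀ F : 𝓢((Fin n → EuclideanSpace ℝ (Fin 4)), ℂ), IsOffDiagonal F →
      Tendsto (fun j => ∑' x : Fin n → Site 4,
        (((∫ U, ∏ i, (plane G r (q i) (x i) U - ∫ V, plane G r (q i) (x i) V ∂(μ (φ j))) ∂(μ (φ j)) : ℝ) : ℂ)) *
          F (fun l => a (β (φ j)) • siteToE (x l) + o (φ j) l)) atTop (𝓝 (S F)))
    (t : EuclideanSpace ℝ (Fin 4)) (F : 𝓢((Fin n → EuclideanSpace ℝ (Fin 4)), ℂ)) (hF : IsOffDiagonal F) :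
    S (translateMulti t F) = S F := by
  obtain ⟨Cp, hCp⟩ := exists_abs_plane_le (G := G) r
  have hCp0 : 0 ≤ Cp := le_trans (abs_nonneg _) (hCp (0, 1) 0 (fun _ => 1))
  haveI : ∀ k, IsProbabilityMeasure (μ k) := fun k => by
    obtain ⟨S', -, hlim⟩ := hμ k
    exact hlim.1
  have ha1 : ∀ k, a (β k) ≤ 1 := fun k => (ha24 k).trans (by norm_num)
  have hsa : ∀ k, 6 * a (β k) ≤ 1 / 4 := fun k => by linarith [ha24 k]
  -- shorthand: weights, evaluation maps
  set W : ℕ → (Fin n → Site 4) → ℝ := fun k x =>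
    ∫ U, ∏ i, (plane G r (q i) (x i) U - ∫ V, plane G r (q i) (x i) V ∂(μ k)) ∂(μ k) with hWdef
  set y : ℕ → (Fin n → Site 4) → (Fin n → EuclideanSpace ℝ (Fin 4)) := fun k x l =>
    a (β k) • siteToE (x l) + o k l with hydef
  have hyx : ∀ k x l, ‖y k x l - a (β k) • siteToE (x l)‖ ≤ 6 * a (β k) := fun k x l => by
    simp only [hydef, add_sub_cancel_left]
    linarith [ho k l, (ha k).le]
  have hWsup : ∀ k x, |W k x| ≤ (Cp + Cp) ^ n := fun k x => abs_infVolWeight_le r hCp (μ k) q x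
  have hWcol : ∀ k (x : Fin n → Site 4) (R : ℕ), 1 ≤ R → (R : ℝ) * a (β k) ≤ ℓ₄ →
      (∀ i j : Fin n, i ≠ j → ∃ m : Fin 4, (2 * (R : ℤ) + 4) ≤ |x i m - x j m|) →
      |W k x| ≤ (Cn n / (R : ℝ) ^ 4 * (((R : ℝ) * a (β k))⁻¹) ^ σ) ^ n := fun k x R hR hRa hsep =>
    momentBound_oddTorusLimitPoints r Cn σ H (hβ k) (hμ k) q x R hq hR hRa hsep
  -- the functionals along `φ`
  set s : ℕ → 𝓢((Fin n → EuclideanSpace ℝ (Fin 4)), ℂ) → ℂ := fun j F =>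
    ∑' x : Fin n → Site 4, ((W (φ j) x : ℝ) : ℂ) * F (y (φ j) x) with hsdef
  have hsum : ∀ j (F : 𝓢((Fin n → EuclideanSpace ℝ (Fin 4)), ℂ)),
      Summable fun x : Fin n → Site 4 => ((W (φ j) x : ℝ) : ℂ) * F (y (φ j) x) := fun j F =>
    summable_mul_of_bounded (ha (φ j)) (ha1 (φ j)) (hsa (φ j)) (pow_nonneg (by positivity) n) (W (φ j))
      (hWsup (φ j)) F (y (φ j)) (hyx (φ j))
  have hsub : ∀ j (F G' : 𝓢((Fin n → EuclideanSpace ℝ (Fin 4)), ℂ)), IsOffDiagonal F → IsOffDiagonal G' →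
      s j (F - G') = s j F - s j G' := fun j F G' _ _ => by
    simp only [hsdef]
    rw [← Summable.tsum_sub (hsum j F) (hsum j G')]
    exact tsum_congr fun x => by simp only [sub_apply]; ring
  set K : ℝ := ((Cp + Cp) * 4 ^ 4 * 5 ^ 6 + (Cp + Cp) * 2 ^ 6 * (10 + 2 * 6) ^ 4 +
      2 ^ (σ + 11) * Cn n * (2 / ℓ₄ + 48) ^ (σ + 4)) * 2 ^ 6 * (81 * ∑' m : ℕ, (((m : ℝ) + 1) ^ 2)⁻¹) with hK
  have hbd : ∀ j (F : 𝓢((Fin n → EuclideanSpace ℝ (Fin 4)), ℂ)), IsOffDiagonal F →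
      ‖s j F‖ ≤ 7 * K ^ n * schwartzNorm ((σ + 10) * n) F := fun j F hF =>
    norm_tsum_weight_mul_le_slack hℓ (hC n) (by positivity : 0 ≤ Cp + Cp) σ (W (φ j)) (hWsup (φ j)) (hWcol (φ j))
      (ha (φ j)) (ha1 (φ j)) (haℓ (φ j)) hn (by norm_num) le_rfl (hsa (φ j)) F hF (y (φ j)) (hyx (φ j))
  -- lattice vectors approximating `t`, exact invariance along the sequence
  have hv := fun j => exists_latticeVector_near (ha (φ j)) t
  choose v hv using hv
  have hbt : Tendsto (fun j => a (β (φ j)) • siteToE (v j)) atTop (𝓝 t) := by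
    have ha0' : Tendsto (fun j => 2 * a (β (φ j))) atTop (𝓝 0) := by
      simpa using (ha0.comp hφ.tendsto_atTop).const_mul 2
    rw [tendsto_iff_norm_sub_tendsto_zero]
    refine squeeze_zero (fun j => norm_nonneg _) (fun j => ?_) ha0'
    rw [norm_sub_rev]; exact hv j
  have hinv : ∀ j (F : 𝓢((Fin n → EuclideanSpace ℝ (Fin 4)), ℂ)), IsOffDiagonal F →
      s j (translateMulti (a (β (φ j)) • siteToE (v j)) F) = s j F := fun j F _ => by
    simp only [hsdef, hydef]
    exact tsum_weight_mul_translateMulti (W (φ j)) (v j)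
      (fun x => infVolWeight_translate_oddTorusLimitPoints r (hμ (φ j)) q x (v j)) _ (o (φ j)) F
  exact translate_eq_of_tendsto s S hsub hbd hconv hbt hinv F hF

/-- **THE COMPACTNESS STEP WITH TRANSLATIONS, per-order constants** (verbatim
`InfiniteVolume.exists_subseq_limit_translate_oddTorusLimitPoints` with `C ↦ Cn n`, `K ↦ K n`; the sup constant
`Cₚ` of the plane fields is returned so that the E0′ constant is explicit and affine in `Cn n`). [folklore] -/
theorem exists_subseq_limit_translate_oddTorusLimitPoints (r : LatticeRep G) {a : ℝ → ℝ} (Cn : ℕ → ℝ) (σ : ℕ)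
    {β₄ ℓ₄ : ℝ} (hℓ : 0 < ℓ₄) (hC : ∀ n, 0 ≤ Cn n)
    (H : ∀ β : ℝ, β₄ ≤ β →
      ∀ (L n : ℕ) (q : Fin n → Fin 4 × Fin 4) (x : Fin n → (Fin 4 → ℤ)) (R : ℕ), (∀ i, (q i).1 < (q i).2) →
        1 ≤ R → (R : ℝ) * a β ≤ ℓ₄ → 4 * R + 8 ≤ L →
        (∀ i j : Fin n, i ≠ j → ∃ k : Fin 4,
          (2 * (R : ℤ) + 4) ≤ |((((x i k - x j k : ℤ) : ZMod (2 * L + 1))).valMinAbs : ℤ)|) →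
        |torusE G r β L (fun U => ∏ i, (plane G r (q i) (x i) U - torusE G r β L (plane G r (q i) (x i))))| ≤
          (Cn n / (R : ℝ) ^ 4 * (((R : ℝ) * a β)⁻¹) ^ σ) ^ n) :
    ∃ Cp : ℝ, 0 ≤ Cp ∧
      ∀ (β : ℕ → ℝ), (∀ k, β₄ ≤ β k) → (∀ k, 0 < a (β k)) → (∀ k, a (β k) ≤ 1 / 24) → (∀ k, a (β k) ≤ ℓ₄) →
        Tendsto (fun k => a (β k)) atTop (𝓝 0) →
      ∀ (μ : ℕ → Measure (LGConfig 4 G)), (∀ k, μ k ∈ oddTorusLimitPoints r (β k)) →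
      ∀ (o : ℕ → (n : ℕ) → (Fin n → Fin 4 × Fin 4) → Fin n → EuclideanSpace ℝ (Fin 4)),
        (∀ k n q l, ‖o k n q l‖ ≤ 5 * a (β k)) →
      ∃ φ : ℕ → ℕ, StrictMono φ ∧
        ∃ S : (n : ℕ) → (Fin n → Fin 4 × Fin 4) → (𝓢((Fin n → EuclideanSpace ℝ (Fin 4)), ℂ) →L[ℂ] ℂ),
          (∀ n q F, ‖S n q F‖ ≤
            7 * ((((Cp + Cp) * 4 ^ 4 * 5 ^ 6 + (Cp + Cp) * 2 ^ 6 * (10 + 2 * 6) ^ 4 +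
              2 ^ (σ + 11) * Cn n * (2 / ℓ₄ + 48) ^ (σ + 4)) * 2 ^ 6 * (81 * ∑' m : ℕ, (((m : ℝ) + 1) ^ 2)⁻¹)) ^ n) *
              schwartzNorm ((σ + 10) * n) F) ∧
          (∀ n : ℕ, 2 ≤ n → ∀ q : Fin n → Fin 4 × Fin 4, (∀ i, (q i).1 < (q i).2) →
            ∀ F : 𝓢((Fin n → EuclideanSpace ℝ (Fin 4)), ℂ), IsOffDiagonal F →
              Tendsto (fun j => ∑' x : Fin n → Site 4,
                (((∫ U, ∏ i, (plane G r (q i) (x i) U - ∫ V, plane G r (q i) (x i) V ∂(μ (φ j))) ∂(μ (φ j)) : ℝ)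
                  : ℂ)) * F (fun l => a (β (φ j)) • siteToE (x l) + o (φ j) n q l)) atTop (𝓝 (S n q F))) ∧
          ∀ n : ℕ, 2 ≤ n → ∀ q : Fin n → Fin 4 × Fin 4, (∀ i, (q i).1 < (q i).2) →
            ∀ (t : EuclideanSpace ℝ (Fin 4)) (F : 𝓢((Fin n → EuclideanSpace ℝ (Fin 4)), ℂ)), IsOffDiagonal F →
              S n q (translateMulti t F) = S n q F := by
  obtain ⟨Cp, hCp0, hex⟩ := exists_subseq_limit_oddTorusLimitPoints r Cn σ hℓ hC H
  refine ⟨Cp, hCp0, ?_⟩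
  intro β hβ ha ha24 haℓ ha0 μ hμ o ho
  have hy : ∀ k n (q : Fin n → Fin 4 × Fin 4) (x : Fin n → Site 4) l,
      ‖(fun l => a (β k) • siteToE (x l) + o k n q l) l - a (β k) • siteToE (x l)‖ ≤ 6 * a (β k) :=
    fun k n q x l => by
      simp only [add_sub_cancel_left]
      linarith [ho k n q l, (ha k).le]
  obtain ⟨φ, hφ, S, hS, hconv⟩ := hex β hβ ha ha24 haℓ μ hμ
    (fun k n q x l => a (β k) • siteToE (x l) + o k n q l) hy
  refine ⟨φ, hφ, S, hS, hconv, fun n hn q hq t F hF => ?_⟩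
  exact translateMulti_invariant_of_tendsto_oddTorusLimitPoints r Cn σ hℓ hC H β hβ ha ha24 haℓ ha0 μ hμ hn q hq
    (fun k => o k n q) (fun k l => ho k n q l) hφ (S n q) (hconv n hn q hq) t F hF

end OddTorus

end Summit.QuantumFields.YangMills.Theorems.InfiniteVolume.PerOrderSlack

end
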